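import Mathlib
import HarnessLib
import Literature.Analysis.FluidPDE.VectorCalculus
import Literature.Analysis.FluidPDE.VectorCalculusProofs
import Literature.Analysis.FluidPDE.VorticityCalculus
import Literature.Analysis.FluidPDE.SpaceTimeMollifier
import Literature.Analysis.FluidPDE.TaoEnstrophyLocalisationProofs
import Literature.Analysis.FluidPDE.CurlFreeLiouville

/-!
# Route `LocalSineTubeDoor`, crux `ProfileAlignedWindowRigidity` (stmt-NavierStokesRegularity-20018) —
# support file 1/3: slice calculus (analyticity of `curl`, identity-theorem spreading, slice planarity)

Port to `Theorems/` of the slice-level part of the cell proof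
`Summit.NavierStokesRegularity.NavierStokesRegularity.Cell.NsRegP1c.profileAlignedWindowRigidity_holds`
(cell ns-regularity-ideate, seat p1, file `Sketch5.lean`/`Sketch8A.lean`, kernel-checked there; this seat p6 lands
it as route-directed support, `--supports stmt-NavierStokesRegularity-20018`).  Pure vector calculus on
`ℝ³ = EuclideanSpace ℝ (Fin 3)`, no Navier–Stokes input:

* `cross_eq_zero_spread` — (E) identity-theorem spreading: if `F` is real-analytic and `F × e = 0` on a
  nonempty open set, then `F × e = 0` everywhere (fed with `F = curl v(s)`, analytic by the tree's
  `Literature.Analysis.FluidPDE.analyticOnNhd_curl`);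
* `translate_eq_of_cross_curl_eq_zero` — (S) the SLICE PLANARITY LEMMA: a bounded `C³` divergence-free field
  with bounded gradient whose curl is everywhere parallel to `e` is invariant under translations along `e`
  (`ω × e = 0`, `div ω = 0` ⇒ `∂ₑ ω = 0` ⇒ `∂ₑ V` is curl-free, divergence-free and bounded, hence constant by
  the tree's Liouville theorem `eq_of_curl_eq_zero_of_isDivFree_of_bounded` (KNSS 2009, Lemma 3.1 / proof of
  Thm 5.2), hence `0` since `V` is bounded).

Companion files: `LocalSineTubeDoorProfileAlignedWindowRigidityAncient.lean` (Oseen-ancient class: analyticity,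
forward/backward propagation of slice invariance, slice gradient bound) and
`LocalSineTubeDoorProfileAlignedWindowRigidity.lean` (the Type-I planar Liouville step and the route decl).
WHAT THIS IS NOT: not a claim about Navier–Stokes regularity; support lemmas for a DRAFT route's crux.
-/

noncomputable section

open Set Filter Function
open scoped Topology
open Literature.Analysis Literature.Analysis.FluidPDE

namespace Summit.NavierStokesRegularity.NavierStokesRegularity.Theorems.LocalSineTubeDoorProfileAlignedWindowRigidityPlanarity

/-! ### Identity-theorem spreading (the curl of an analytic field is analytic: tree `analyticOnNhd_curl`) -/

/-- **(E) identity-theorem spreading** for `y ↦ F(y) × e`: if `F` is real-analytic on `ℝ³` and `F × e`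
vanishes on a nonempty open set, it vanishes everywhere (`ℝ³` is preconnected). -/
theorem cross_eq_zero_spread {F : (EuclideanSpace ℝ (Fin 3)) → (EuclideanSpace ℝ (Fin 3))} (hF : AnalyticOnNhd ℝ F univ) (e : (EuclideanSpace ℝ (Fin 3)))
    {U : Set (EuclideanSpace ℝ (Fin 3))} (hU : IsOpen U) (hne : U.Nonempty) (h : ∀ y ∈ U, cross (F y) e = 0) :
    ∀ y, cross (F y) e = 0 := by
  have hG : AnalyticOnNhd ℝ (fun y => cross (F y) e) univ := by
    have h1 := (crossCLM.flip e).comp_analyticOnNhd hF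
    simpa [Function.comp_def, crossCLM_apply] using h1
  obtain ⟨y₀, hy₀⟩ := hne
  have hev : (fun y => cross (F y) e) =ᶠ[𝓝 y₀] 0 :=
    Filter.eventually_of_mem (hU.mem_nhds hy₀) fun y hy => h y hy
  intro y
  have := hG.eqOn_zero_of_preconnected_of_eventuallyEq_zero isPreconnected_univ (mem_univ y₀) hev
    (mem_univ y)
  simpa using this

/-! ### (S) the slice planarity lemma

`ω := curl V = φ • e` componentwise from `ω × e = 0`; `∂ₑ ω = (∂ₑ φ) e = (div ω) e = 0`
(`divergence_curl_eq_zero_holds`, `divergence_smul_const`); `W := ∂ₑ V` has `curl W = ∂ₑ ω = 0`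
(`curl_fderiv_apply`), `div W = 0` (`IsDivFree.fderiv_apply`), `‖W‖ ≤ M'‖e‖`, hence is constant
(`eq_of_curl_eq_zero_of_isDivFree_of_bounded`); `V (y + l e) = V y + l • c` and `V` bounded force `c = 0`. -/

/-- Components of `a × e = 0`: `aᵢ eₖ = aₖ eᵢ`. -/
theorem mul_comm_of_cross_eq_zero {a e : (EuclideanSpace ℝ (Fin 3))} (h : cross a e = 0) (i k : Fin 3) :
    a i * e k = a k * e i := by
  have h' : ∀ j : Fin 3, (cross a e) j = 0 := fun j => by rw [h]; rfl
  have h0 := h' 0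
  have h1 := h' 1
  have h2 := h' 2
  simp only [cross, PiLp.toLp_apply, cross_apply, Matrix.cons_val_zero, Matrix.cons_val_one,
    Matrix.cons_val_two, Matrix.head_cons, Matrix.tail_cons] at h0 h1 h2
  fin_cases i <;> fin_cases k <;> simp <;> linarith

/-- If `a × e = 0` and `eₖ ≠ 0` then `a = (aₖ / eₖ) • e`. -/
theorem eq_smul_of_cross_eq_zero {a e : (EuclideanSpace ℝ (Fin 3))} (h : cross a e = 0) {k : Fin 3} (hk : e k ≠ 0) :
    a = (a k / e k) • e := by
  ext i
  rw [PiLp.smul_apply, smul_eq_mul, div_mul_eq_mul_div, eq_div_iff hk]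
  exact mul_comm_of_cross_eq_zero h i k

/-- A nonzero vector of `ℝ³` has a nonzero coordinate. -/
theorem exists_apply_ne_zero {e : (EuclideanSpace ℝ (Fin 3))} (he : e ≠ 0) : ∃ k : Fin 3, e k ≠ 0 := by
  by_contra h
  push Not at h
  exact he (PiLp.ext fun k => by rw [h k]; rfl)

/-- **(P1)** If `curl V` is everywhere parallel to `e` (`V ∈ C³`), then `∂ₑ (curl V) = 0`. -/
theorem fderiv_curl_apply_eq_zero {V : (EuclideanSpace ℝ (Fin 3)) → (EuclideanSpace ℝ (Fin 3))} (hV : ContDiff ℝ 3 V) {e : (EuclideanSpace ℝ (Fin 3))}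
    (hal : ∀ y, cross (curl V y) e = 0) (x : (EuclideanSpace ℝ (Fin 3))) : fderiv ℝ (curl V) x e = 0 := by
  by_cases he : e = 0
  · simp [he]
  obtain ⟨k, hk⟩ := exists_apply_ne_zero he
  have hV2 : ContDiff ℝ 2 V := hV.of_le (by norm_cast)
  have hω2 : ContDiff ℝ 2 (curl V) := contDiff_curl (n := 2) (by exact_mod_cast hV)
  -- the scalar amplitude `φ = ωₖ / eₖ`
  set φ : (EuclideanSpace ℝ (Fin 3)) → ℝ := fun y => curl V y k / e k with hφdef
  have hφ2 : ContDiff ℝ 2 φ := by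
    have h1 : ContDiff ℝ 2 fun y => curl V y k :=
      (EuclideanSpace.proj k : (EuclideanSpace ℝ (Fin 3)) →L[ℝ] ℝ).contDiff.comp hω2
    exact h1.div_const _
  have hφd : Differentiable ℝ φ := hφ2.differentiable (by norm_num)
  have hωφ : curl V = fun y => φ y • e := funext fun y => eq_smul_of_cross_eq_zero (hal y) hk
  -- `∂ₑ φ = div ω = 0`
  have hdφ : fderiv ℝ φ x e = 0 := by
    rw [← divergence_smul_const e (hφd x), ← hωφ]
    exact divergence_curl_eq_zero_holds V hV2 x
  rw [hωφ, fderiv_smul_const (hφd x) e, ContinuousLinearMap.smulRight_apply, hdφ, zero_smul]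

/-- **(P2)** Under the hypotheses of (S), the directional derivative `∂ₑ V` is constant. -/
theorem fderiv_apply_const {V : (EuclideanSpace ℝ (Fin 3)) → (EuclideanSpace ℝ (Fin 3))} (hV : ContDiff ℝ 3 V) (hdiv : VectorCalculus.IsDivFree V)
    {M' : ℝ} (hM' : ∀ y, ‖fderiv ℝ V y‖ ≤ M') {e : (EuclideanSpace ℝ (Fin 3))} (hal : ∀ y, cross (curl V y) e = 0)
    (x y : (EuclideanSpace ℝ (Fin 3))) : fderiv ℝ V x e = fderiv ℝ V y e := by
  have hV2 : ContDiff ℝ 2 V := hV.of_le (by norm_cast)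
  have hW2 : ContDiff ℝ 2 fun z => fderiv ℝ V z e :=
    (hV.fderiv_right (m := 2) (by norm_cast)).clm_apply contDiff_const
  have hcurl : ∀ z, curl (fun w => fderiv ℝ V w e) z = 0 := fun z => by
    rw [curl_fderiv_apply hV2 z e, fderiv_curl_apply_eq_zero hV hal z]
  have hdivW : VectorCalculus.IsDivFree fun z => fderiv ℝ V z e := hdiv.fderiv_apply hV2 e
  have hbd : ∀ z, ‖fderiv ℝ V z e‖ ≤ M' * ‖e‖ := fun z =>
    ((fderiv ℝ V z).le_opNorm e).trans (mul_le_mul_of_nonneg_right (hM' z) (norm_nonneg e))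
  exact eq_of_curl_eq_zero_of_isDivFree_of_bounded hW2 hcurl hdivW hbd x y

/-- **(S) THE SLICE PLANARITY LEMMA.** A bounded `C³` divergence-free field `V : ℝ³ → ℝ³` with bounded
gradient whose curl is everywhere parallel to `e` (`curl V × e = 0`) is invariant under translations along
`e`: `V (y + l • e) = V y`.  (Giga–Miura 2011 §2 / KNSS 2009 proof of Thm 5.2 use the global version
"unidirectional vorticity ⇒ two-dimensional flow"; here it is a pure calculus fact about one slice.) -/
theorem translate_eq_of_cross_curl_eq_zero {V : (EuclideanSpace ℝ (Fin 3)) → (EuclideanSpace ℝ (Fin 3))} {e : (EuclideanSpace ℝ (Fin 3))} (hV : ContDiff ℝ 3 V)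
    (hdiv : VectorCalculus.IsDivFree V) {M : ℝ} (hM : ∀ y, ‖V y‖ ≤ M) {M' : ℝ}
    (hM' : ∀ y, ‖fderiv ℝ V y‖ ≤ M') (hal : ∀ y, cross (curl V y) e = 0) (y : (EuclideanSpace ℝ (Fin 3))) (l : ℝ) :
    V (y + l • e) = V y := by
  have hV1 : Differentiable ℝ V := hV.differentiable (by norm_num)
  -- the constant value of `∂ₑ V`
  set c : (EuclideanSpace ℝ (Fin 3)) := fderiv ℝ V 0 e with hc
  have hconst : ∀ z, fderiv ℝ V z e = c := fun z => fderiv_apply_const hV hdiv hM' hal z 0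
  -- the line map `g l = V (y + l e)` has derivative `c`
  set g : ℝ → (EuclideanSpace ℝ (Fin 3)) := fun l => V (y + l • e) with hg
  have hgd : ∀ l, HasDerivAt g c l := fun l => by
    have hline : HasDerivAt (fun l : ℝ => y + l • e) e l := by
      simpa using ((hasDerivAt_id l).smul_const e).const_add y
    have h := (hV1 (y + l • e)).hasFDerivAt.comp_hasDerivAt l hline
    rwa [hconst] at h
  -- hence `g l − l • c` is constant
  have hd : ∀ l, HasDerivAt (fun l => g l - l • c) 0 l := fun l => by
    have h := (hgd l).sub ((hasDerivAt_id' l).smul_const c)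
    simp only [one_smul, sub_self] at h
    exact h
  have hh : ∀ l, g l - l • c = g 0 - (0 : ℝ) • c := fun l =>
    is_const_of_deriv_eq_zero (f := fun l => g l - l • c) (fun l => (hd l).differentiableAt)
      (fun l => (hd l).deriv) l 0
  have hlin : ∀ l, V (y + l • e) = V y + l • c := fun l => by
    have := hh l
    simp only [hg, zero_smul, sub_zero, zero_smul, add_zero] at this
    rw [← this]; abel
  -- boundedness of `V` forces `c = 0`
  have hc0 : c = 0 := by
    by_contra hne
    have hcpos : 0 < ‖c‖ := norm_pos_iff.2 hne
    set l : ℝ := (2 * M + 1) / ‖c‖ with hl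
    have hM0 : 0 ≤ M := (norm_nonneg _).trans (hM y)
    have h1 : ‖l • c‖ ≤ 2 * M := by
      have : l • c = V (y + l • e) - V y := by rw [hlin l]; abel
      rw [this]
      exact (norm_sub_le _ _).trans (by linarith [hM (y + l • e), hM y])
    have h2 : ‖l • c‖ = 2 * M + 1 := by
      rw [norm_smul, Real.norm_eq_abs, abs_of_nonneg (by positivity), hl,
        div_mul_cancel₀ _ hcpos.ne']
    linarith
  rw [hlin l, hc0, smul_zero, add_zero]

end Summit.NavierStokesRegularity.NavierStokesRegularity.Theorems.LocalSineTubeDoorProfileAlignedWindowRigidityPlanarity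

end
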